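import Summits.BirchSwinnertonDyer.Rank1Residual.X10.MuTransferThreeOfFineShaCells
import HarnessLib

/-!
# Class X10b (N2), the F1 ROAD at `p = 3`: per-cell kernel RECORDS for Ш-CELLS, part 03 — Miller's `BSD(E,3)`
# AT THE PAIR modulo Kato's zeta-element package F1 + PUBLISHED named facts + displayed census / certificate binders,
# for the EIGHT N2 Ш-cells not reached by parts 01–02: the seven cells of image `3Nn` (`#Ш_an = 9`) and `395641f1`
# (`3Ns`, `#Ш_an = 36`) — each carries an exact `3`-descent `#Sel^(3)(E/ℚ) = 9` of record (24649b1, 174887i1, 264992dm1, 288800ba1, 307520ca1, 323008bo1, 395641f1, 453152bq1)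
# (cell `b2b-bsdres`, unit `b2b-bsdres-x10` = N2 class lead, GEN 42; records — theorems only, no definition,
# no named fact, nothing booked)

HONEST FRAMING (run/shared/lean/b2b/bsd-rank1-residual/, verbatim in every file): the goal of the
cell is to DELETE the COMBINATION-SHAPED residual classes of the Birch–Swinnerton-Dyer formula for
ALL analytic-rank `≤ 1` elliptic curves over `ℚ` — "full BSD formula for every rank `≤ 1` curve in
class `C`" assembled STRICTLY from published theorems — so that the rank-`≤ 1` remainder becomes
exactly the CONSTRUCTION-SHAPED classes, which are TYPED (missing-input `Prop`s), NOT attempted.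
This is not "finishing BSD". Class X10b keeps its label CONSTRUCTION-SHAPED (NEEDS X_A3, RESIDUAL-MAP
§I N2); nothing is booked by this file (the lane books, the referee rules); everything is PER PAIR.

## What (x10 GEN 42, X10-AUDIT §48; TOOL `X10/MuTransferThreeOfFineShaCells.lean`, GEN 41, p489493)

Referee A's round on OFFER-A5-FINEROAD v1 + ADDENDUM-1 (2026-08-27) booked 305 of the 313 N2 cells at `p = 3`
and returned: «the 8 not-reached cells (7 of `3Nn` + `395641f1`) … = the remaining N2 residue at `p = 3`».  GEN 41
had written that no exact `3`-descent for the non-split-Cartan image existed in the cell; that was WRONG: unit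
x10b's X10B-DESC3NS §6.3 (2026-08-19; engine 1 = unit x11b's Schaefer–Stoll `desc3lib.gp`, which handles exactly
the one-orbit case `3Nn`) and X678-DESC3 §2 (2026-08-20; engine 2 = `desc3full_e2.py`, an independent
re-implementation, cross-checked subspace by subspace) give `dim_𝔽₃ Sel^(3)(E/ℚ) = 2` EXACT on BOTH engines for
all seven `3Nn` Ш-cells, and the two-engine `desc3ns` (X10B-DESC3NS Thm. A, §6.2) gives the same for `395641f1`.
So for each Ш-cell `E` below (analytic rank `0`; Cremona minimal model; `3 ∤ Δ`, ordinary point count at `3` and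
an `E[3]`-irreducibility witness DECIDED in the kernel, EITHER image): Miller's `BSD(E,3)` from F1 (`hfine`: the
UPPER half `ord₃ #Ш ≤ ord₃ #Ш_an` via Kato 17.4-from-F1 + the `μ`-transfer) and ONE exact `3`-descent
`hcard : #Sel^(3)(E/ℚ) = 9` (the LOWER half: at rank `0` with `E[3]` irreducible, `#(Ш ⊓ H¹(ℚ,E)[3]) = #Sel^(3)`,
Silverman X.4.2 (a), so `9 ∣ #Ш`) — NO Cassels–Tate pairing certificate, NO Cassels–Tate squareness, NO Wuthrich.
DISPLAYED: F1; PUBLISHED `hS` (A35), `hmodP` (A19), `hGZK` (A18), `h3` (A25); census / certificates `hL`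
(`L(E,1) ≠ 0`), `hcertA` (MUCERT3, three engines, 313/313), `hcard` (the two-engine exact `3`-descent of record),
`hq`/`hv` (`ord₃ #Ш_an = 2`: `#Ш_an = 9`, resp. `36` for `395641f1`, Cremona).  With parts 01–02 and
`X10/FineRoadBSDRecords01–30` EVERY one of the 313 N2 cells carries a per-pair `BSD(E,3)` kernel record on the
F1 road.  Keys: `class-closure/N2/FINEROAD-SHA2-x10g42.tsv`.

References: [Kato2004Asterisque] Thm. 12.6, Thm. 17.4, §17.13; [SilvermanAEC2009] Thm. X.4.2 (a);
[GreenbergLNM1716] Thm. 4.1; [Mazur1978] Prop. 6.3 (1); [Miller2011LMS] Def. 1.1; [SchaeferStoll2004] (the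
`3`-descent realising `hcard`); [Cremona2006] tables.
-/

set_option autoImplicit false

noncomputable section

open scoped Classical MatrixGroups ModularForm

open CongruenceSubgroup WeierstrassCurve Field Literature.NumberTheory.EllipticCurves
  Literature.NumberTheory.EllipticCurves.ModularForms Literature.NumberTheory.EllipticCurves.Rank1Residual
  Literature.NumberTheory.EllipticCurves.Kato2004
  Literature.NumberTheory.EllipticCurves.Rank1Residual.X11RankOneCertificates
  Summit.BirchSwinnertonDyer.BirchSwinnertonDyer.Rank1Residual.IntModel
  Summit.BirchSwinnertonDyer.BirchSwinnertonDyer.Theorems.Rank1ResidualX1Defs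
  Summit.BirchSwinnertonDyer.BirchSwinnertonDyer.Rank1Residual

namespace Summit.BirchSwinnertonDyer.Rank1Residual.X10.MuZeroRoad

/-! ### `24649b1` (3Nn, `N = 24649 = 157^2`, analytic rank `0`, `#Ш_an = 9` — Ш-CELL, core A5 cell) -/

/-- **`BSD(E,3)` AT THE PAIR `(24649b1, 3)` MODULO F1 + PUBLISHED FACTS + CERTIFICATES — Ш-cell on the F1 road**
(`MuZeroRoad.bsdp_three_shaCell_of_ainvs_of_fine_of_card_selmerThree`: F1 upper half + ONE exact `3`-descent lower
half; NO CTP pairing certificate). Cremona model `[1, 1, 1, -1048096, 551582926]`, `N = 24649 = 157^2`, census image `3Nn`; IN THE KERNEL: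
`3 ∤ Δ`, `#Ẽ(𝔽₃) = 2` (`a₃ = 2`: good ORDINARY), Frobenius witness `ℓ = 5`: `ℓ ∤ Δ`, `#Ẽ(𝔽_{5}) = 2`
(`a_{5} = 4`), `X² − a_{5}X + 5` root-free mod `3` (`E[3]` irreducible). Cremona `allbsd`: analytic rank `0`,
`#E(ℚ)_tors = 1`, `∏ c_ℓ = 2`, `#Ш_an = 9`. DISPLAYED: F1 (`hfine`); PUBLISHED `hS`, `hmodP`, `hGZK`, `h3`; census /
certificates `hL`, `hcertA` (MUCERT3), `hcard` (`#Sel^(3)(E/ℚ) = 9`: two-engine EXACT 3-descent of record, `dim Sel₃ = 2`: engine 1 = unit x11b `desc3lib.gp` (Schaefer–Stoll, octic algebra; kit j064130, `HOME/b2b-bsdres-x10b/x11b_3Nn/j064130/summary.tsv`, X10B-DESC3NS §6.3) × engine 2 = unit x10b `desc3full_e2.py` (kit j092536, `HOME/b2b-bsdres-x10b/desc3full/j092536/e2_summary.tsv`: EXACT(bnfcertify1+3sat), `xcheck_same_subspace = True`, X678-DESC3 §2)), `hq`/`hv` (`ord₃ #Ш_an = 2`). Per pair;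
nothing booked. [cite: Kato2004Asterisque, Thm. 12.6 (p. 222), Thm. 17.4 (2), (3) (p. 273) and §17.13 (pp. 279–280)]
[cite: SilvermanAEC2009, Thm. X.4.2 (a)] [cite: Mazur1978, §6 Prop. 6.3 (1) (p. 153)]
[cite: Miller2011LMS, Def. 1.1 (arXiv:1010.2431 p. 3)] [cite: Cremona2006, Table 1 (Cremona label 24649b1)] -/
theorem bsdp_three_sha_e24649b1_of_fine
    (hfine : exists_divisibilityInputs_fineQuotient_zeta)
    (hS : Schneider1985_order_charGenerator_odd) (hmodP : nonempty_modularParametrizationData)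
    (hGZK : rank_eq_analyticRank_of_analyticRank_le_one) (h3 : realPeriodRat_eq_unit_mul_plusPeriod_three)
    (W : WeierstrassCurve ℚ) [W.IsElliptic] [W.IsGloballyMinimal]
    (hI : integralModelInt W = ⟨1, 1, 1, (-1048096), 551582926⟩) (hL : W.entireLFunction 1 ≠ 0)
    (hcertA : ∀ {N : ℕ} [NeZero N] (f : CuspForm (Gamma0 N) 2), IsNewformOf W f →
      ∃ n : ℕ, ‖PowerSeries.coeff n (padicLFunction f (unitRoot W 3 : ℚ_[3]))‖ = 1)
    (hcard : Nat.card (W.selmerGroup (3 : ℤ)) = 9)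
    {q : ℚ} (hq : shaAn W = (q : ℂ)) (hv : padicValRat 3 q = 2) : BSDp W 3 :=
  haveI : Fact (Nat.Prime 5) := ⟨by norm_num⟩
  bsdp_three_shaCell_of_ainvs_of_fine_of_card_selmerThree hfine hS hmodP hGZK h3 1 1 1 (-1048096) 551582926 hI
    5 2 2 (by decide +kernel) (by decide +kernel) (by decide) (by decide) (by decide) (by decide +kernel)
    (by decide +kernel) (by decide +kernel) hL hcertA hcard hq hv.le

/-! ### `174887i1` (3Nn, `N = 174887 = 47·61^2`, analytic rank `0`, `#Ш_an = 9` — Ш-CELL) -/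

/-- **`BSD(E,3)` AT THE PAIR `(174887i1, 3)` MODULO F1 + PUBLISHED FACTS + CERTIFICATES — Ш-cell on the F1 road**
(`MuZeroRoad.bsdp_three_shaCell_of_ainvs_of_fine_of_card_selmerThree`: F1 upper half + ONE exact `3`-descent lower
half; NO CTP pairing certificate). Cremona model `[1, 0, 1, -10616091, -13419603915]`, `N = 174887 = 47·61^2`, census image `3Nn`; IN THE KERNEL:
`3 ∤ Δ`, `#Ẽ(𝔽₃) = 3` (`a₃ = 1`: good ORDINARY, ANOMALOUS), Frobenius witness `ℓ = 7`: `ℓ ∤ Δ`, `#Ẽ(𝔽_{7}) = 8`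
(`a_{7} = 0`), `X² − a_{7}X + 7` root-free mod `3` (`E[3]` irreducible). Cremona `allbsd`: analytic rank `0`,
`#E(ℚ)_tors = 1`, `∏ c_ℓ = 2`, `#Ш_an = 9`. DISPLAYED: F1 (`hfine`); PUBLISHED `hS`, `hmodP`, `hGZK`, `h3`; census /
certificates `hL`, `hcertA` (MUCERT3), `hcard` (`#Sel^(3)(E/ℚ) = 9`: two-engine EXACT 3-descent of record, `dim Sel₃ = 2`: engine 1 = unit x11b `desc3lib.gp` (Schaefer–Stoll, octic algebra; kit j064130, `HOME/b2b-bsdres-x10b/x11b_3Nn/j064130/summary.tsv`, X10B-DESC3NS §6.3) × engine 2 = unit x10b `desc3full_e2.py` (kit j092536, `HOME/b2b-bsdres-x10b/desc3full/j092536/e2_summary.tsv`: EXACT(bnfcertify1+3sat), `xcheck_same_subspace = True`, X678-DESC3 §2)), `hq`/`hv` (`ord₃ #Ш_an = 2`). Per pair;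
nothing booked. [cite: Kato2004Asterisque, Thm. 12.6 (p. 222), Thm. 17.4 (2), (3) (p. 273) and §17.13 (pp. 279–280)]
[cite: SilvermanAEC2009, Thm. X.4.2 (a)] [cite: Mazur1978, §6 Prop. 6.3 (1) (p. 153)]
[cite: Miller2011LMS, Def. 1.1 (arXiv:1010.2431 p. 3)] [cite: Cremona2006, Table 1 (Cremona label 174887i1)] -/
theorem bsdp_three_sha_e174887i1_of_fine
    (hfine : exists_divisibilityInputs_fineQuotient_zeta)
    (hS : Schneider1985_order_charGenerator_odd) (hmodP : nonempty_modularParametrizationData)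
    (hGZK : rank_eq_analyticRank_of_analyticRank_le_one) (h3 : realPeriodRat_eq_unit_mul_plusPeriod_three)
    (W : WeierstrassCurve ℚ) [W.IsElliptic] [W.IsGloballyMinimal]
    (hI : integralModelInt W = ⟨1, 0, 1, (-10616091), (-13419603915)⟩) (hL : W.entireLFunction 1 ≠ 0)
    (hcertA : ∀ {N : ℕ} [NeZero N] (f : CuspForm (Gamma0 N) 2), IsNewformOf W f →
      ∃ n : ℕ, ‖PowerSeries.coeff n (padicLFunction f (unitRoot W 3 : ℚ_[3]))‖ = 1)
    (hcard : Nat.card (W.selmerGroup (3 : ℤ)) = 9)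
    {q : ℚ} (hq : shaAn W = (q : ℂ)) (hv : padicValRat 3 q = 2) : BSDp W 3 :=
  haveI : Fact (Nat.Prime 7) := ⟨by norm_num⟩
  bsdp_three_shaCell_of_ainvs_of_fine_of_card_selmerThree hfine hS hmodP hGZK h3 1 0 1 (-10616091) (-13419603915) hI
    7 8 3 (by decide +kernel) (by decide +kernel) (by decide) (by decide) (by decide) (by decide +kernel)
    (by decide +kernel) (by decide +kernel) hL hcertA hcard hq hv.le

/-! ### `264992dm1` (3Nn, `N = 264992 = 2^5·7^2·13^2`, analytic rank `0`, `#Ш_an = 9` — Ш-CELL) -/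

/-- **`BSD(E,3)` AT THE PAIR `(264992dm1, 3)` MODULO F1 + PUBLISHED FACTS + CERTIFICATES — Ш-cell on the F1 road**
(`MuZeroRoad.bsdp_three_shaCell_of_ainvs_of_fine_of_card_selmerThree`: F1 upper half + ONE exact `3`-descent lower
half; NO CTP pairing certificate). Cremona model `[0, -1, 0, -19322, 5476808]`, `N = 264992 = 2^5·7^2·13^2`, census image `3Nn`; IN THE KERNEL:
`3 ∤ Δ`, `#Ẽ(𝔽₃) = 2` (`a₃ = 2`: good ORDINARY), Frobenius witness `ℓ = 5`: `ℓ ∤ Δ`, `#Ẽ(𝔽_{5}) = 4`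
(`a_{5} = 2`), `X² − a_{5}X + 5` root-free mod `3` (`E[3]` irreducible). Cremona `allbsd`: analytic rank `0`,
`#E(ℚ)_tors = 2`, `∏ c_ℓ = 8`, `#Ш_an = 9`. DISPLAYED: F1 (`hfine`); PUBLISHED `hS`, `hmodP`, `hGZK`, `h3`; census /
certificates `hL`, `hcertA` (MUCERT3), `hcard` (`#Sel^(3)(E/ℚ) = 9`: two-engine EXACT 3-descent of record, `dim Sel₃ = 2`: engine 1 = unit x11b `desc3lib.gp` (Schaefer–Stoll, octic algebra; kit j064127, `HOME/b2b-bsdres-x10b/x11b_3Nn/j064127/summary.tsv`, X10B-DESC3NS §6.3) × engine 2 = unit x10b `desc3full_e2.py` (kit j092536, `HOME/b2b-bsdres-x10b/desc3full/j092536/e2_summary.tsv`: EXACT(bnfcertify1+3sat), `xcheck_same_subspace = True`, X678-DESC3 §2)), `hq`/`hv` (`ord₃ #Ш_an = 2`). Per pair;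
nothing booked. [cite: Kato2004Asterisque, Thm. 12.6 (p. 222), Thm. 17.4 (2), (3) (p. 273) and §17.13 (pp. 279–280)]
[cite: SilvermanAEC2009, Thm. X.4.2 (a)] [cite: Mazur1978, §6 Prop. 6.3 (1) (p. 153)]
[cite: Miller2011LMS, Def. 1.1 (arXiv:1010.2431 p. 3)] [cite: Cremona2006, Table 1 (Cremona label 264992dm1)] -/
theorem bsdp_three_sha_e264992dm1_of_fine
    (hfine : exists_divisibilityInputs_fineQuotient_zeta)
    (hS : Schneider1985_order_charGenerator_odd) (hmodP : nonempty_modularParametrizationData)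
    (hGZK : rank_eq_analyticRank_of_analyticRank_le_one) (h3 : realPeriodRat_eq_unit_mul_plusPeriod_three)
    (W : WeierstrassCurve ℚ) [W.IsElliptic] [W.IsGloballyMinimal]
    (hI : integralModelInt W = ⟨0, (-1), 0, (-19322), 5476808⟩) (hL : W.entireLFunction 1 ≠ 0)
    (hcertA : ∀ {N : ℕ} [NeZero N] (f : CuspForm (Gamma0 N) 2), IsNewformOf W f →
      ∃ n : ℕ, ‖PowerSeries.coeff n (padicLFunction f (unitRoot W 3 : ℚ_[3]))‖ = 1)
    (hcard : Nat.card (W.selmerGroup (3 : ℤ)) = 9)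
    {q : ℚ} (hq : shaAn W = (q : ℂ)) (hv : padicValRat 3 q = 2) : BSDp W 3 :=
  haveI : Fact (Nat.Prime 5) := ⟨by norm_num⟩
  bsdp_three_shaCell_of_ainvs_of_fine_of_card_selmerThree hfine hS hmodP hGZK h3 0 (-1) 0 (-19322) 5476808 hI
    5 4 2 (by decide +kernel) (by decide +kernel) (by decide) (by decide) (by decide) (by decide +kernel)
    (by decide +kernel) (by decide +kernel) hL hcertA hcard hq hv.le

/-! ### `288800ba1` (3Nn, `N = 288800 = 2^5·5^2·19^2`, analytic rank `0`, `#Ш_an = 9` — Ш-CELL) -/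

/-- **`BSD(E,3)` AT THE PAIR `(288800ba1, 3)` MODULO F1 + PUBLISHED FACTS + CERTIFICATES — Ш-cell on the F1 road**
(`MuZeroRoad.bsdp_three_shaCell_of_ainvs_of_fine_of_card_selmerThree`: F1 upper half + ONE exact `3`-descent lower
half; NO CTP pairing certificate). Cremona model `[0, -1, 0, -73791408, -1232224411688]`, `N = 288800 = 2^5·5^2·19^2`, census image `3Nn`; IN THE KERNEL:
`3 ∤ Δ`, `#Ẽ(𝔽₃) = 5` (`a₃ = -1`: good ORDINARY), Frobenius witness `ℓ = 7`: `ℓ ∤ Δ`, `#Ẽ(𝔽_{7}) = 5`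
(`a_{7} = 3`), `X² − a_{7}X + 7` root-free mod `3` (`E[3]` irreducible). Cremona `allbsd`: analytic rank `0`,
`#E(ℚ)_tors = 1`, `∏ c_ℓ = 4`, `#Ш_an = 9`. DISPLAYED: F1 (`hfine`); PUBLISHED `hS`, `hmodP`, `hGZK`, `h3`; census /
certificates `hL`, `hcertA` (MUCERT3), `hcard` (`#Sel^(3)(E/ℚ) = 9`: two-engine EXACT 3-descent of record, `dim Sel₃ = 2`: engine 1 = unit x11b `desc3lib.gp` (Schaefer–Stoll, octic algebra; kit j064130, `HOME/b2b-bsdres-x10b/x11b_3Nn/j064130/summary.tsv`, X10B-DESC3NS §6.3) × engine 2 = unit x10b `desc3full_e2.py` (kit j092536, `HOME/b2b-bsdres-x10b/desc3full/j092536/e2_summary.tsv`: EXACT(bnfcertify1+3sat), `xcheck_same_subspace = True`, X678-DESC3 §2)), `hq`/`hv` (`ord₃ #Ш_an = 2`). Per pair;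
nothing booked. [cite: Kato2004Asterisque, Thm. 12.6 (p. 222), Thm. 17.4 (2), (3) (p. 273) and §17.13 (pp. 279–280)]
[cite: SilvermanAEC2009, Thm. X.4.2 (a)] [cite: Mazur1978, §6 Prop. 6.3 (1) (p. 153)]
[cite: Miller2011LMS, Def. 1.1 (arXiv:1010.2431 p. 3)] [cite: Cremona2006, Table 1 (Cremona label 288800ba1)] -/
theorem bsdp_three_sha_e288800ba1_of_fine
    (hfine : exists_divisibilityInputs_fineQuotient_zeta)
    (hS : Schneider1985_order_charGenerator_odd) (hmodP : nonempty_modularParametrizationData)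
    (hGZK : rank_eq_analyticRank_of_analyticRank_le_one) (h3 : realPeriodRat_eq_unit_mul_plusPeriod_three)
    (W : WeierstrassCurve ℚ) [W.IsElliptic] [W.IsGloballyMinimal]
    (hI : integralModelInt W = ⟨0, (-1), 0, (-73791408), (-1232224411688)⟩) (hL : W.entireLFunction 1 ≠ 0)
    (hcertA : ∀ {N : ℕ} [NeZero N] (f : CuspForm (Gamma0 N) 2), IsNewformOf W f →
      ∃ n : ℕ, ‖PowerSeries.coeff n (padicLFunction f (unitRoot W 3 : ℚ_[3]))‖ = 1)
    (hcard : Nat.card (W.selmerGroup (3 : ℤ)) = 9)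
    {q : ℚ} (hq : shaAn W = (q : ℂ)) (hv : padicValRat 3 q = 2) : BSDp W 3 :=
  haveI : Fact (Nat.Prime 7) := ⟨by norm_num⟩
  bsdp_three_shaCell_of_ainvs_of_fine_of_card_selmerThree hfine hS hmodP hGZK h3 0 (-1) 0 (-73791408) (-1232224411688) hI
    7 5 5 (by decide +kernel) (by decide +kernel) (by decide) (by decide) (by decide) (by decide +kernel)
    (by decide +kernel) (by decide +kernel) hL hcertA hcard hq hv.le

/-! ### `307520ca1` (3Nn, `N = 307520 = 2^6·5·31^2`, analytic rank `0`, `#Ш_an = 9` — Ш-CELL) -/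

/-- **`BSD(E,3)` AT THE PAIR `(307520ca1, 3)` MODULO F1 + PUBLISHED FACTS + CERTIFICATES — Ш-cell on the F1 road**
(`MuZeroRoad.bsdp_three_shaCell_of_ainvs_of_fine_of_card_selmerThree`: F1 upper half + ONE exact `3`-descent lower
half; NO CTP pairing certificate). Cremona model `[0, 1, 0, -5104191, -4440280141]`, `N = 307520 = 2^6·5·31^2`, census image `3Nn`; IN THE KERNEL:
`3 ∤ Δ`, `#Ẽ(𝔽₃) = 3` (`a₃ = 1`: good ORDINARY, ANOMALOUS), Frobenius witness `ℓ = 7`: `ℓ ∤ Δ`, `#Ẽ(𝔽_{7}) = 8`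
(`a_{7} = 0`), `X² − a_{7}X + 7` root-free mod `3` (`E[3]` irreducible). Cremona `allbsd`: analytic rank `0`,
`#E(ℚ)_tors = 1`, `∏ c_ℓ = 2`, `#Ш_an = 9`. DISPLAYED: F1 (`hfine`); PUBLISHED `hS`, `hmodP`, `hGZK`, `h3`; census /
certificates `hL`, `hcertA` (MUCERT3), `hcard` (`#Sel^(3)(E/ℚ) = 9`: two-engine EXACT 3-descent of record, `dim Sel₃ = 2`: engine 1 = unit x11b `desc3lib.gp` (Schaefer–Stoll, octic algebra; kit j064129, `HOME/b2b-bsdres-x10b/x11b_3Nn/j064129/summary.tsv`, X10B-DESC3NS §6.3) × engine 2 = unit x10b `desc3full_e2.py` (kit j092536, `HOME/b2b-bsdres-x10b/desc3full/j092536/e2_summary.tsv`: EXACT(bnfcertify1+3sat), `xcheck_same_subspace = True`, X678-DESC3 §2)), `hq`/`hv` (`ord₃ #Ш_an = 2`). Per pair;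
nothing booked. [cite: Kato2004Asterisque, Thm. 12.6 (p. 222), Thm. 17.4 (2), (3) (p. 273) and §17.13 (pp. 279–280)]
[cite: SilvermanAEC2009, Thm. X.4.2 (a)] [cite: Mazur1978, §6 Prop. 6.3 (1) (p. 153)]
[cite: Miller2011LMS, Def. 1.1 (arXiv:1010.2431 p. 3)] [cite: Cremona2006, Table 1 (Cremona label 307520ca1)] -/
theorem bsdp_three_sha_e307520ca1_of_fine
    (hfine : exists_divisibilityInputs_fineQuotient_zeta)
    (hS : Schneider1985_order_charGenerator_odd) (hmodP : nonempty_modularParametrizationData)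
    (hGZK : rank_eq_analyticRank_of_analyticRank_le_one) (h3 : realPeriodRat_eq_unit_mul_plusPeriod_three)
    (W : WeierstrassCurve ℚ) [W.IsElliptic] [W.IsGloballyMinimal]
    (hI : integralModelInt W = ⟨0, 1, 0, (-5104191), (-4440280141)⟩) (hL : W.entireLFunction 1 ≠ 0)
    (hcertA : ∀ {N : ℕ} [NeZero N] (f : CuspForm (Gamma0 N) 2), IsNewformOf W f →
      ∃ n : ℕ, ‖PowerSeries.coeff n (padicLFunction f (unitRoot W 3 : ℚ_[3]))‖ = 1)
    (hcard : Nat.card (W.selmerGroup (3 : ℤ)) = 9)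
    {q : ℚ} (hq : shaAn W = (q : ℂ)) (hv : padicValRat 3 q = 2) : BSDp W 3 :=
  haveI : Fact (Nat.Prime 7) := ⟨by norm_num⟩
  bsdp_three_shaCell_of_ainvs_of_fine_of_card_selmerThree hfine hS hmodP hGZK h3 0 1 0 (-5104191) (-4440280141) hI
    7 8 3 (by decide +kernel) (by decide +kernel) (by decide) (by decide) (by decide) (by decide +kernel)
    (by decide +kernel) (by decide +kernel) hL hcertA hcard hq hv.le

/-! ### `323008bo1` (3Nn, `N = 323008 = 2^6·7^2·103`, analytic rank `0`, `#Ш_an = 9` — Ш-CELL) -/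

/-- **`BSD(E,3)` AT THE PAIR `(323008bo1, 3)` MODULO F1 + PUBLISHED FACTS + CERTIFICATES — Ш-cell on the F1 road**
(`MuZeroRoad.bsdp_three_shaCell_of_ainvs_of_fine_of_card_selmerThree`: F1 upper half + ONE exact `3`-descent lower
half; NO CTP pairing certificate). Cremona model `[0, 1, 0, -3021601, -2023474433]`, `N = 323008 = 2^6·7^2·103`, census image `3Nn`; IN THE KERNEL:
`3 ∤ Δ`, `#Ẽ(𝔽₃) = 3` (`a₃ = 1`: good ORDINARY, ANOMALOUS), Frobenius witness `ℓ = 5`: `ℓ ∤ Δ`, `#Ẽ(𝔽_{5}) = 2`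
(`a_{5} = 4`), `X² − a_{5}X + 5` root-free mod `3` (`E[3]` irreducible). Cremona `allbsd`: analytic rank `0`,
`#E(ℚ)_tors = 1`, `∏ c_ℓ = 8`, `#Ш_an = 9`. DISPLAYED: F1 (`hfine`); PUBLISHED `hS`, `hmodP`, `hGZK`, `h3`; census /
certificates `hL`, `hcertA` (MUCERT3), `hcard` (`#Sel^(3)(E/ℚ) = 9`: two-engine EXACT 3-descent of record, `dim Sel₃ = 2`: engine 1 = unit x11b `desc3lib.gp` (Schaefer–Stoll, octic algebra; kit j064130, `HOME/b2b-bsdres-x10b/x11b_3Nn/j064130/summary.tsv`, X10B-DESC3NS §6.3) × engine 2 = unit x10b `desc3full_e2.py` (kit j092536, `HOME/b2b-bsdres-x10b/desc3full/j092536/e2_summary.tsv`: EXACT(bnfcertify1+3sat), `xcheck_same_subspace = True`, X678-DESC3 §2)), `hq`/`hv` (`ord₃ #Ш_an = 2`). Per pair;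
nothing booked. [cite: Kato2004Asterisque, Thm. 12.6 (p. 222), Thm. 17.4 (2), (3) (p. 273) and §17.13 (pp. 279–280)]
[cite: SilvermanAEC2009, Thm. X.4.2 (a)] [cite: Mazur1978, §6 Prop. 6.3 (1) (p. 153)]
[cite: Miller2011LMS, Def. 1.1 (arXiv:1010.2431 p. 3)] [cite: Cremona2006, Table 1 (Cremona label 323008bo1)] -/
theorem bsdp_three_sha_e323008bo1_of_fine
    (hfine : exists_divisibilityInputs_fineQuotient_zeta)
    (hS : Schneider1985_order_charGenerator_odd) (hmodP : nonempty_modularParametrizationData)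
    (hGZK : rank_eq_analyticRank_of_analyticRank_le_one) (h3 : realPeriodRat_eq_unit_mul_plusPeriod_three)
    (W : WeierstrassCurve ℚ) [W.IsElliptic] [W.IsGloballyMinimal]
    (hI : integralModelInt W = ⟨0, 1, 0, (-3021601), (-2023474433)⟩) (hL : W.entireLFunction 1 ≠ 0)
    (hcertA : ∀ {N : ℕ} [NeZero N] (f : CuspForm (Gamma0 N) 2), IsNewformOf W f →
      ∃ n : ℕ, ‖PowerSeries.coeff n (padicLFunction f (unitRoot W 3 : ℚ_[3]))‖ = 1)
    (hcard : Nat.card (W.selmerGroup (3 : ℤ)) = 9)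
    {q : ℚ} (hq : shaAn W = (q : ℂ)) (hv : padicValRat 3 q = 2) : BSDp W 3 :=
  haveI : Fact (Nat.Prime 5) := ⟨by norm_num⟩
  bsdp_three_shaCell_of_ainvs_of_fine_of_card_selmerThree hfine hS hmodP hGZK h3 0 1 0 (-3021601) (-2023474433) hI
    5 2 3 (by decide +kernel) (by decide +kernel) (by decide) (by decide) (by decide) (by decide +kernel)
    (by decide +kernel) (by decide +kernel) hL hcertA hcard hq hv.le

/-! ### `395641f1` (3Ns, `N = 395641 = 17^2·37^2`, analytic rank `0`, `#Ш_an = 36` — Ш-CELL) -/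

/-- **`BSD(E,3)` AT THE PAIR `(395641f1, 3)` MODULO F1 + PUBLISHED FACTS + CERTIFICATES — Ш-cell on the F1 road**
(`MuZeroRoad.bsdp_three_shaCell_of_ainvs_of_fine_of_card_selmerThree`: F1 upper half + ONE exact `3`-descent lower
half; NO CTP pairing certificate). Cremona model `[0, 1, 1, -24934614623, -1515437094749663]`, `N = 395641 = 17^2·37^2`, census image `3Ns`; IN THE KERNEL:
`3 ∤ Δ`, `#Ẽ(𝔽₃) = 3` (`a₃ = 1`: good ORDINARY, ANOMALOUS), Frobenius witness `ℓ = 13`: `ℓ ∤ Δ`, `#Ẽ(𝔽_{13}) = 20`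
(`a_{13} = -6`), `X² − a_{13}X + 13` root-free mod `3` (`E[3]` irreducible). Cremona `allbsd`: analytic rank `0`,
`#E(ℚ)_tors = 1`, `∏ c_ℓ = 4`, `#Ш_an = 36`. DISPLAYED: F1 (`hfine`); PUBLISHED `hS`, `hmodP`, `hGZK`, `h3`; census /
certificates `hL`, `hcertA` (MUCERT3), `hcard` (`#Sel^(3)(E/ℚ) = 9`: two-engine × two-side EXACT 3-descent of record, `dim Sel₃ = 2`: unit x10b `desc3ns` engines 1, 2 on sides q_a, q_b (kit j066574, `HOME/b2b-bsdres-x10b/desc3ns/X10B3NS_table.tsv`: 4/4 runs agree, exact_all, xcheck both sides; X10B-DESC3NS Thm A, §6.2)), `hq`/`hv` (`ord₃ #Ш_an = 2`). Per pair;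
nothing booked. [cite: Kato2004Asterisque, Thm. 12.6 (p. 222), Thm. 17.4 (2), (3) (p. 273) and §17.13 (pp. 279–280)]
[cite: SilvermanAEC2009, Thm. X.4.2 (a)] [cite: Mazur1978, §6 Prop. 6.3 (1) (p. 153)]
[cite: Miller2011LMS, Def. 1.1 (arXiv:1010.2431 p. 3)] [cite: Cremona2006, Table 1 (Cremona label 395641f1)] -/
theorem bsdp_three_sha_e395641f1_of_fine
    (hfine : exists_divisibilityInputs_fineQuotient_zeta)
    (hS : Schneider1985_order_charGenerator_odd) (hmodP : nonempty_modularParametrizationData)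
    (hGZK : rank_eq_analyticRank_of_analyticRank_le_one) (h3 : realPeriodRat_eq_unit_mul_plusPeriod_three)
    (W : WeierstrassCurve ℚ) [W.IsElliptic] [W.IsGloballyMinimal]
    (hI : integralModelInt W = ⟨0, 1, 1, (-24934614623), (-1515437094749663)⟩) (hL : W.entireLFunction 1 ≠ 0)
    (hcertA : ∀ {N : ℕ} [NeZero N] (f : CuspForm (Gamma0 N) 2), IsNewformOf W f →
      ∃ n : ℕ, ‖PowerSeries.coeff n (padicLFunction f (unitRoot W 3 : ℚ_[3]))‖ = 1)
    (hcard : Nat.card (W.selmerGroup (3 : ℤ)) = 9)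
    {q : ℚ} (hq : shaAn W = (q : ℂ)) (hv : padicValRat 3 q = 2) : BSDp W 3 :=
  haveI : Fact (Nat.Prime 13) := ⟨by norm_num⟩
  bsdp_three_shaCell_of_ainvs_of_fine_of_card_selmerThree hfine hS hmodP hGZK h3 0 1 1 (-24934614623) (-1515437094749663) hI
    13 20 3 (by decide +kernel) (by decide +kernel) (by decide) (by decide) (by decide) (by decide +kernel)
    (by decide +kernel) (by decide +kernel) hL hcertA hcard hq hv.le

/-! ### `453152bq1` (3Nn, `N = 453152 = 2^5·7^2·17^2`, analytic rank `0`, `#Ш_an = 9` — Ш-CELL) -/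

/-- **`BSD(E,3)` AT THE PAIR `(453152bq1, 3)` MODULO F1 + PUBLISHED FACTS + CERTIFICATES — Ш-cell on the F1 road**
(`MuZeroRoad.bsdp_three_shaCell_of_ainvs_of_fine_of_card_selmerThree`: F1 upper half + ONE exact `3`-descent lower
half; NO CTP pairing certificate). Cremona model `[0, -1, 0, -33042, -12221992]`, `N = 453152 = 2^5·7^2·17^2`, census image `3Nn`; IN THE KERNEL:
`3 ∤ Δ`, `#Ẽ(𝔽₃) = 2` (`a₃ = 2`: good ORDINARY), Frobenius witness `ℓ = 5`: `ℓ ∤ Δ`, `#Ẽ(𝔽_{5}) = 4`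
(`a_{5} = 2`), `X² − a_{5}X + 5` root-free mod `3` (`E[3]` irreducible). Cremona `allbsd`: analytic rank `0`,
`#E(ℚ)_tors = 2`, `∏ c_ℓ = 8`, `#Ш_an = 9`. DISPLAYED: F1 (`hfine`); PUBLISHED `hS`, `hmodP`, `hGZK`, `h3`; census /
certificates `hL`, `hcertA` (MUCERT3), `hcard` (`#Sel^(3)(E/ℚ) = 9`: two-engine EXACT 3-descent of record, `dim Sel₃ = 2`: engine 1 = unit x11b `desc3lib.gp` (Schaefer–Stoll, octic algebra; kit j064133, `HOME/b2b-bsdres-x10b/x11b_3Nn/j064133/summary.tsv`, X10B-DESC3NS §6.3) × engine 2 = unit x10b `desc3full_e2.py` (kit j092536, `HOME/b2b-bsdres-x10b/desc3full/j092536/e2_summary.tsv`: EXACT(bnfcertify1+3sat), `xcheck_same_subspace = True`, X678-DESC3 §2)), `hq`/`hv` (`ord₃ #Ш_an = 2`). Per pair;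
nothing booked. [cite: Kato2004Asterisque, Thm. 12.6 (p. 222), Thm. 17.4 (2), (3) (p. 273) and §17.13 (pp. 279–280)]
[cite: SilvermanAEC2009, Thm. X.4.2 (a)] [cite: Mazur1978, §6 Prop. 6.3 (1) (p. 153)]
[cite: Miller2011LMS, Def. 1.1 (arXiv:1010.2431 p. 3)] [cite: Cremona2006, Table 1 (Cremona label 453152bq1)] -/
theorem bsdp_three_sha_e453152bq1_of_fine
    (hfine : exists_divisibilityInputs_fineQuotient_zeta)
    (hS : Schneider1985_order_charGenerator_odd) (hmodP : nonempty_modularParametrizationData)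
    (hGZK : rank_eq_analyticRank_of_analyticRank_le_one) (h3 : realPeriodRat_eq_unit_mul_plusPeriod_three)
    (W : WeierstrassCurve ℚ) [W.IsElliptic] [W.IsGloballyMinimal]
    (hI : integralModelInt W = ⟨0, (-1), 0, (-33042), (-12221992)⟩) (hL : W.entireLFunction 1 ≠ 0)
    (hcertA : ∀ {N : ℕ} [NeZero N] (f : CuspForm (Gamma0 N) 2), IsNewformOf W f →
      ∃ n : ℕ, ‖PowerSeries.coeff n (padicLFunction f (unitRoot W 3 : ℚ_[3]))‖ = 1)
    (hcard : Nat.card (W.selmerGroup (3 : ℤ)) = 9)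
    {q : ℚ} (hq : shaAn W = (q : ℂ)) (hv : padicValRat 3 q = 2) : BSDp W 3 :=
  haveI : Fact (Nat.Prime 5) := ⟨by norm_num⟩
  bsdp_three_shaCell_of_ainvs_of_fine_of_card_selmerThree hfine hS hmodP hGZK h3 0 (-1) 0 (-33042) (-12221992) hI
    5 4 2 (by decide +kernel) (by decide +kernel) (by decide) (by decide) (by decide) (by decide +kernel)
    (by decide +kernel) (by decide +kernel) hL hcertA hcard hq hv.le

end Summit.BirchSwinnertonDyer.Rank1Residual.X10.MuZeroRoad

end
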